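import Summits.Langlands.Langlands.Theses.QuarterDeficit1951
import Literature.NumberTheory.GaloisRepresentations.UnramifiedDatum
import Literature.NumberTheory.GaloisRepresentations.GaloisRepUnramifiedProofs
import Literature.NumberTheory.GaloisRepresentations.ArtinConductorProofs
import Literature.NumberTheory.Automorphic.BCDTTheoremBWildAtThreeDet
import Literature.NumberTheory.GaloisRepresentations.UnramifiedCrystallineRings
import Literature.NumberTheory.GaloisRepresentations.UnramifiedLabelledWeights

/-!
# Disproof of `IcosahedralSupply` — findings (cdisprove, stmt-Langlands-15899, cycle 1)

Crux (route `QuarterDeficit1951`, item stmt-Langlands-15899, rank 9, support):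
`∀ RD ℓ [prime], 17 ≤ ℓ → ∃ ι ρ, IsGeometricFramed RD ρ ∧ irreducible ∧ finite image ∧ even ∧
artinConductorNat = 1951 ∧ ∃ χ₀ (order 5), ∀ v ∤ 1951, unramified ∧ Frobenius data`.

VERDICT OF THIS CYCLE: **no kill**. The crux is TRUE IN SUBSTANCE at every `ℓ ≠ 1951`
(Doud–Moore 2006: the even icosahedral Artin representations of conductor `1951`, type 3a;
transported into `ℚ̄_ℓ` along `ι⁻¹`, open kernel), and at `ℓ = 1951` it is INDEPENDENT of the tree
as typed (neither provable nor refutable): see §A. Nothing in it is vacuous or trivially true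
(`IsComplexConjugation`, `Ideal.inertia`, `IsArithFrobAt`, the upper-numbering filtration behind
`artinConductorNat` are all faithful constructions, read 2026-08-16).

## §A Load-bearing analysis — the PIN is load-bearing (PROVED, `icosahedralSupply_false_without_pin`;
LANDED as `Summits/Langlands/Langlands/Theorems/IcosahedralSupply/Negative/FalseWithoutPin.lean`,
proposal p128124, namespace `…Theorems.IcosahedralSupply.Negative`, place-generic form `w ∣ 1951`)

The only `p`-adic Hodge input of the crux is the identity of the pinned datum
`RD.pst ℓ v hv = fontainePstAdicCompletion v ℓ hv = Classical.epsilon (IsFontaineDatum _)`.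
Replace the pin by an ARBITRARY datum family (`IcosahedralSupplyWithoutPin`, a strengthening:
it implies the crux, `icosahedralSupply_of_withoutPin`) and the statement is FALSE: at
`ℓ = 1951` (prime, `≥ 17`, hence in scope) the accepted truncated datum `F̂_nr`
(`unramifiedPstWeilDeligneData`, which inhabits `PstWeilDeligneData` and satisfies every
STRUCTURE axiom) makes de Rham = unramified (`unramifiedPstWeilDeligneData_isDeRhamFramed_iff`),
whereas every `ρ` with `artinConductorNat ρ = 1951` unramified away from `1951` is RAMIFIED at
`1951` (`not_isUnramifiedAt_of_artinConductorNat`, §B). Consequence for provers: ANY proof of the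
crux must use a property of `Classical.epsilon (IsFontaineDatum _)` beyond the structure axioms —
i.e. a clause of `IsFontaineDatum` under `FontaineDatumExists` — and clauses (F1)–(F8) say nothing
about RAMIFIED potentially-unramified representations (only unramified ones and `χ_cyc`). So the
`ℓ = 1951` instance is an unfillable stub until either clause (F9) "potentially unramified ⇒ de
Rham" is added to `IsFontaineDatum` (crux idea `fontaine-clause-f9-potentially-unramified`), or
the planner RESTATES the crux with `ℓ ≠ 1951` (or `ℓ = 17`: `closes` uses `h₃ RD 17 le_rfl`
only; `CorrespondentFingerprint` already carries `ℓ ≠ 1951`). Recommended repair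
C′ := `∀ RD ℓ [prime], 17 ≤ ℓ → ℓ ≠ 1951 → ∃ ι ρ, …` (verbatim otherwise).

## §A′ Which clauses are live (sharpening; LANDED as `…/Theorems/IcosahedralSupply/Negative/FalseWithoutCyclotomicClauses.lean`, p128424)

Granting the datum family every clause of `IsFontaineDatum` that the truncated datum PROVABLY
satisfies — (F1) canonical `ℚ_ℓ`-structure (rfl), (F3) `UnramifiedWeightsZero`, (F5)/(F6) Kisin
ring existence (`unramifiedPstWeilDeligneData_hasCrystallineDeformationRings`,
`…_hasHodgeTypeCrystallineDeformationRings`), (F8) Frobenius normalisation on unramified `ρ` — the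
uniform statement is STILL false (`icosahedralSupply_false_without_cyclotomic_clauses`). So under
`FontaineDatumExists` a proof of the crux as typed must squeeze de Rham-ness of a RAMIFIED
finite-image `ρ|_{Γ_{ℚ_1951}}` out of (F2) `CyclotomicWeightNegOne`, (F4) `χ_cyc` crystalline, or
(F7) `CrystallineGenericFibreRegular`: two clauses about the infinitely ramified cyclotomic
character and one about regularity of the datum's own crystalline deformation rings. Informally
(ideator 2's `B₅ = ⋃_{5 ∤ [F′:F]} F′ ⊗ B_st` model, NegativeEpsilonIndependence1951.md) even these do
not suffice; that last step is metatheory (an XL construction), not a tree theorem.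

## §B Tightness — conductor `1951` forces ramification at `1951` (PROVED)

`artinConductorNat_eq_one_of_forall_isUnramifiedAt`: everywhere unramified ⇒ conductor `1`
(tree: `artinConductor_eq_top_of_forall_isUnramifiedAt_holds`, `Ideal.absNorm_top`).
Hence the conjuncts "conductor 1951" and "unramified at every `v ∤ 1951`" force `ρ` ramified at
the place above `1951`; at `ℓ = 1951` this is the place `v ∣ ℓ` of the de Rham clause.

## §C Why the crux resists refutation (for the record)

* `IsGeometricFramed` at `ℓ ≠ 1951`: FREE for every datum (structure axiom
  `isDeRhamWith_of_isLocallyUnramified` + proved bridge `isUnramifiedAt_iff_toLocal_holds`;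
  `isDeRhamFramed_pin_of_isUnramifiedAt` below, also in the ideators' sketches).
* `ℓ = 1951`: irrefutable — refuting needs `¬ IsDeRhamFramed (Classical.epsilon _) ρloc`, i.e.
  falsity for EVERY datum with Fontaine's clauses, but the genuine `B_dR` satisfies them and makes
  finite-image `ρ` de Rham.
* Arithmetic conjuncts: `Ideal.inertia`/`IsArithFrobAt` (Mathlib), `absUpperRamificationSubgroup`
  (iInf over finite normal subextensions of genuine upper-numbering groups) are faithful; for a
  finite-image `ρ` tame at `1951` with inertia acting as `1 ⊕ η`, `η` of order 5:
  `codimFixed I = 1`, Swan `= 0`, exponent `1`, `artinConductorNat = 1951` — consistent.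
  `IsEven` uses genuine complex conjugations (`ComplexEmbedding.IsConj`). `orderOf χ₀ = 5`:
  the four order-5 characters mod the prime `1951 ≡ 1 (mod 5)` exist; `χ₀ ↦ χ₀⁻¹` absorbs the
  arithmetic/geometric Frobenius convention. Fingerprint `t⁴ − 3dt² + d² = 0 ↔ t²/d = (3 ± √5)/2`
  (projective order 5), `t² = d` (order 3), `t = 0` (order 2), `t² = 4d` (order 1): exactly the
  element orders of `A₅`.
* Hypothesis `17 ≤ ℓ`: dropping it does not falsify anything checkable (true in substance at
  every prime `ℓ ≠ 1951`, including `ℓ ∣ 600`); it is route bookkeeping (`closes` at `ℓ = 17`).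
  MISSING side condition instead: `ℓ ≠ 1951`.
* Vendored-fact gap (prover information, not falsity): `DoudMoore2006_minimalPrimeConductor`
  does not record type 3a (`e₁₉₅₁ = 5`); conductor `1951` alone admits type 3b (`1951 ≡ 1 mod 3`),
  so `orderOf χ₀ = 5` needs the sharpened cite (ideator note NOTES-r1-k1 §F3).

-- Targets: payload `stuck_stubs = []`. -- Line Sketch (PICKED 22:02Z, skeleton Lines/Sketch.lean
22:12Z, read in this session): seven stubs. `stub_deRham_finiteImage_1951` = the ℓ = 1951 de Rham
clause for ALL finite-image ρ and the ε-datum: MISSTATED as an obligation (unprovable, irrefutable;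
kernel evidence §A/§A′, §D; note `stub-misstated:` posted with corrected signatures: conditional on
`FontaineDatumExists` + clause (F9), which is ideator 1's proved `isDeRhamFramed_pst_of_isOpen_ker`,
or deleted by the restate `ℓ ≠ 1951`). The six arithmetic stubs — `stub_doudMooreField`
(D = I ≅ C₅ at 1951 is right: Frobenius acts on tame inertia by τ ↦ τ^1951 = τ and C_{A₅}(C₅) = C₅),
`stub_icosahedralEmbedding`, `stub_tateTwistLift` (Serre–Tate, Durham 1977 §6.2 Thm. 5 with local
lifts 1 ⊕ η at v₀ and unramified ones elsewhere), `stub_conductor` (p ∤ |η(I)| ⇒ tame ⇒ Swan = 0,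
codim V^I = 1; `Nat.Coprime p (orderOf _)` excludes infinite order), `stub_frobeniusReadout`
(η(I) = μ₅, Kronecker–Weber ⇒ det of order exactly 5), `stub_irreducible` (any char-0 field k) —
checked on paper: TRUE in substance, no degenerate instance found, no kill.
-/

noncomputable section

set_option linter.dupNamespace false -- `Summit.Langlands.Langlands` is the mandated namespace (D-0017)

open scoped NumberField
open Field IsDedekindDomain
open Literature.NumberTheory.GaloisRepresentations Literature.NumberTheory.PAdicHodge

namespace Summit.Langlands.Langlands.Cruxes.IcosahedralSupply.Disproof

/-! ### §0 The problematic instance is in scope -/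

/-- `ℓ = 1951` is a prime `≥ 17`, so the crux's quantifier `∀ ℓ [prime], 17 ≤ ℓ → …` includes the
residue characteristic of its own conductor. [folklore] -/
theorem prime_1951_and_le : Nat.Prime 1951 ∧ 17 ≤ 1951 := by norm_num

/-! ### §B Tightness: conductor `1951` forces ramification at the place above `1951` -/

section Tightness

variable {A : Type*} [CommRing A] [TopologicalSpace A] [IsTopologicalRing A] [Nontrivial A] {n : ℕ}

/-- An everywhere unramified framed representation of `Γ_ℚ` has numerical Artin conductor `1`
(`𝔣(ρ) = ⊤`, tree theorem `artinConductor_eq_top_of_forall_isUnramifiedAt_holds`). [folklore] -/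
theorem artinConductorNat_eq_one_of_forall_isUnramifiedAt (ρ : FramedGaloisRep ℚ A n)
    (h : ∀ v : HeightOneSpectrum (𝓞 ℚ), ρ.IsUnramifiedAt v) :
    ρ.toGaloisRep.artinConductorNat = 1 := by
  have htop : ρ.toGaloisRep.artinConductor = ⊤ :=
    GaloisRep.artinConductor_eq_top_of_forall_isUnramifiedAt_holds
      (fun v => (FramedGaloisRep.isUnramifiedAt_toGaloisRep_iff v ρ).2 (h v))
  rw [GaloisRep.artinConductorNat, htop, Ideal.absNorm_top]

/-- The place of `ℚ` above `1951`. [folklore] -/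
def v1951 : HeightOneSpectrum (𝓞 ℚ) :=
  (Rat.HeightOneSpectrum.primesEquiv (R := 𝓞 ℚ)).symm ⟨1951, prime_1951_and_le.1⟩

/-- `1951 ∈ v1951`. [folklore] -/
theorem natCast_mem_v1951 : ((1951 : ℕ) : 𝓞 ℚ) ∈ v1951.asIdeal :=
  (Literature.NumberTheory.EllipticCurves.natCast_mem_asIdeal_iff_eq_primesEquiv_symm v1951
    prime_1951_and_le.1).2 rfl

/-- A place `v ≠ v1951` has residue characteristic `≠ 1951`. [folklore] -/
theorem residueCard_ne_of_ne_v1951 {v : HeightOneSpectrum (𝓞 ℚ)} (hv : v ≠ v1951) :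
    v.residueCard ≠ 1951 := by
  set p : Nat.Primes := Rat.HeightOneSpectrum.primesEquiv (R := 𝓞 ℚ) v with hp
  have hvp : v = (Rat.HeightOneSpectrum.primesEquiv (R := 𝓞 ℚ)).symm ⟨p, p.2⟩ := by
    rw [hp]; simp
  have hmem : ((p : ℕ) : 𝓞 ℚ) ∈ v.asIdeal :=
    (Literature.NumberTheory.EllipticCurves.natCast_mem_asIdeal_iff_eq_primesEquiv_symm v p.2).2 hvp
  rw [Rat.residueCard_eq_of_natCast_mem p.2 hmem]
  intro h1951
  apply hv
  rw [hvp, v1951]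
  congr 1
  exact Subtype.ext h1951

/-- **Tightness.** A framed `ρ : Γ_ℚ → GL_n(A)` with `artinConductorNat ρ = 1951` that is
unramified at every place of residue characteristic `≠ 1951` is RAMIFIED at `v1951`
(otherwise it is unramified everywhere and its conductor is `1`). [folklore] -/
theorem not_isUnramifiedAt_of_artinConductorNat (ρ : FramedGaloisRep ℚ A n)
    (hN : ρ.toGaloisRep.artinConductorNat = 1951)
    (hunr : ∀ v : HeightOneSpectrum (𝓞 ℚ), v.residueCard ≠ 1951 → ρ.IsUnramifiedAt v) :
    ¬ ρ.IsUnramifiedAt v1951 := by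
  intro h0
  have hall : ∀ v : HeightOneSpectrum (𝓞 ℚ), ρ.IsUnramifiedAt v := fun v => by
    by_cases hv : v = v1951
    · rw [hv]; exact h0
    · exact hunr v (residueCard_ne_of_ne_v1951 hv)
  have h1 := artinConductorNat_eq_one_of_forall_isUnramifiedAt ρ hall
  omega

end Tightness

/-! ### §C The free half: de Rham for EVERY datum at a place where `ρ` is unramified -/

/-- Local unramifiedness from global: if `ρ` is unramified at `v` then `ρ|_{Γ_{ℚ_v}}` kills the
local inertia group (proved bridge `GaloisRep.isUnramifiedAt_iff_toLocal_holds`, un-framed).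
[folklore] -/
theorem isLocallyUnramified_toLocal_of_isUnramifiedAt {ℓ : ℕ} [Fact ℓ.Prime] {n : ℕ}
    (ρ : FramedGaloisRep ℚ (PadicAlgCl ℓ) n) (v : HeightOneSpectrum (𝓞 ℚ))
    (h : ρ.IsUnramifiedAt v) : (ρ.toLocal v).IsLocallyUnramified := by
  intro σ hσ
  have h1 := ((GaloisRep.isUnramifiedAt_iff_toLocal_holds v ρ.toGaloisRep).1
    ((FramedGaloisRep.isUnramifiedAt_toGaloisRep_iff v ρ).2 h)) σ hσ
  rw [GaloisRep.toLocal_apply] at h1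
  rw [FramedGaloisRep.toLocal_apply]
  have h2 : Matrix.toLin' ((ρ (absGaloisRestrict ℚ (v.adicCompletion ℚ) σ) :
      GL (Fin n) (PadicAlgCl ℓ)) : Matrix (Fin n) (Fin n) (PadicAlgCl ℓ)) = Matrix.toLin' 1 := by
    rw [Matrix.toLin'_one]
    refine LinearMap.ext fun w => ?_
    simpa using congr($h1 w)
  exact Units.ext (Matrix.toLin'.injective h2)

/-- Global unramifiedness from local (converse direction of the same bridge). [folklore] -/
theorem isUnramifiedAt_of_isLocallyUnramified_toLocal {ℓ : ℕ} [Fact ℓ.Prime] {n : ℕ}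
    (ρ : FramedGaloisRep ℚ (PadicAlgCl ℓ) n) (v : HeightOneSpectrum (𝓞 ℚ))
    (h : (ρ.toLocal v).IsLocallyUnramified) : ρ.IsUnramifiedAt v := by
  rw [← FramedGaloisRep.isUnramifiedAt_toGaloisRep_iff]
  refine (GaloisRep.isUnramifiedAt_iff_toLocal_holds v ρ.toGaloisRep).2 fun σ hσ => ?_
  have h1 : (ρ.toLocal v) σ = 1 := h σ hσ
  rw [FramedGaloisRep.toLocal_apply] at h1
  rw [GaloisRep.toLocal_apply]
  refine LinearMap.ext fun w => ?_
  rw [FramedRep.toContinuousRep_apply_apply, h1]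
  simp

/-- **Free de Rham clause** (every datum, in particular the pin; no `FontaineDatumExists`): at a
place `v ∣ ℓ` where `ρ` is unramified, `ρ|_{Γ_{ℚ_v}}` is de Rham for ANY `PstWeilDeligneData`
(structure axiom `isDeRhamWith_of_isLocallyUnramified`). So at `ℓ ≠ 1951` the geometric conjunct
of the crux costs nothing. [folklore] -/
theorem isDeRhamFramed_of_isUnramifiedAt {ℓ : ℕ} [Fact ℓ.Prime] {n : ℕ}
    (ρ : FramedGaloisRep ℚ (PadicAlgCl ℓ) n) (v : HeightOneSpectrum (𝓞 ℚ))
    (𝔇 : PstWeilDeligneData (v.adicCompletion ℚ) ℓ) (h : ρ.IsUnramifiedAt v) :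
    𝔇.IsDeRhamFramed (ρ.toLocal v) :=
  𝔇.isDeRhamFramed_of_isLocallyUnramified (isLocallyUnramified_toLocal_of_isUnramifiedAt ρ v h)

/-! ### §A The pin is load-bearing: the datum-uniform crux is FALSE -/

/-- **`IcosahedralSupply` with the pinned `p`-adic Hodge datum replaced by an ARBITRARY datum
family** `pst ℓ v hv : PstWeilDeligneData ℚ_v ℓ` (universally quantified, outermost); everything
else verbatim (`IsGeometricFramed RD ρ` unfolded, `RD.pst` ↦ `pst`; the then-unused `RD` is
dropped — `ReciprocityData.pst` ignores its `RD` argument by definition). This is what a proof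
"uniform in the datum", i.e. one using only the structure axioms of `PstWeilDeligneData`, would
establish. [folklore] -/
def IcosahedralSupplyWithoutPin : Prop :=
  ∀ (pst : ∀ (ℓ : ℕ) [Fact ℓ.Prime] (v : HeightOneSpectrum (𝓞 ℚ)),
      ((ℓ : ℕ) : 𝓞 ℚ) ∈ v.asIdeal → PstWeilDeligneData (v.adicCompletion ℚ) ℓ)
    (ℓ : ℕ) [Fact ℓ.Prime], 17 ≤ ℓ →
    ∃ (ι : PadicAlgCl ℓ ≃+* ℂ) (ρ : FramedGaloisRep ℚ (PadicAlgCl ℓ) 2),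
      ((∀ᶠ v : HeightOneSpectrum (𝓞 ℚ) in Filter.cofinite, ρ.IsUnramifiedAt v) ∧
        ∀ (v : HeightOneSpectrum (𝓞 ℚ)) (hv : ((ℓ : ℕ) : 𝓞 ℚ) ∈ v.asIdeal),
          (pst ℓ v hv).IsDeRhamFramed (ρ.toLocal v)) ∧
      (ρ.toGaloisRep.IsIrreducible ∧ (Set.range ρ).Finite ∧ ρ.IsEven ∧
        ρ.toGaloisRep.artinConductorNat = 1951 ∧
        ∃ χ₀ : DirichletCharacter ℂ 1951, orderOf χ₀ = 5 ∧
          ∀ v : HeightOneSpectrum (𝓞 ℚ), v.residueCard ≠ 1951 →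
            ρ.IsUnramifiedAt v ∧ ∃ t d : PadicAlgCl ℓ,
              ρ.HasFrobCharpolyAt v
                (Polynomial.X ^ 2 - Polynomial.C t * Polynomial.X + Polynomial.C d) ∧
              ι d = (χ₀ (v.residueCard : ZMod 1951))⁻¹ ∧
              (t ^ 2 = 0 ∨ t ^ 2 = d ∨ t ^ 2 = 4 * d ∨ t ^ 4 - 3 * d * t ^ 2 + d ^ 2 = 0))

/-- The crux IS the pinned instance of the datum-uniform statement: `WithoutPin → crux`
(instantiate `pst := fontainePstAdicCompletion`, which is `RD.pst` by `rfl`). So `WithoutPin` is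
a strengthening and its failure (next theorem) is a statement about PROOFS of the crux, not a
refutation. [folklore] -/
theorem icosahedralSupply_of_withoutPin (h : IcosahedralSupplyWithoutPin) :
    Summit.Langlands.Langlands.Theses.QuarterDeficit1951.IcosahedralSupply := by
  intro RD ℓ _ hℓ
  obtain ⟨ι, ρ, hgeo, hrest⟩ := h (fun ℓ _ v hv => fontainePstAdicCompletion v ℓ hv) ℓ hℓ
  exact ⟨ι, ρ, hgeo, hrest⟩

/-- **The pin is load-bearing: `IcosahedralSupply` cannot be proved uniformly in the `p`-adic
Hodge datum.** Witness: `ℓ = 1951` and the truncated datum family `F̂_nr`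
(`unramifiedPstWeilDeligneData`, installed on the pinned datum's own `ℚ_ℓ`-algebra structure),
for which de Rham ⇔ unramified (`unramifiedPstWeilDeligneData_isDeRhamFramed_iff`); but the
conductor forces ramification at `v1951` (`not_isUnramifiedAt_of_artinConductorNat`).
Any proof of the crux must therefore use a clause of `IsFontaineDatum` about the PINNED datum,
and none of (F1)–(F8) concerns ramified finite-image representations: the `ℓ = 1951` instance
is an unfillable stub as the tree stands (repair: restate with `ℓ ≠ 1951`, or add clause (F9)).
[folklore] -/
theorem icosahedralSupply_false_without_pin : ¬ IcosahedralSupplyWithoutPin := by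
  intro h
  haveI : Fact (Nat.Prime 1951) := ⟨prime_1951_and_le.1⟩
  obtain ⟨ι, ρ, ⟨-, hdR⟩, -, -, -, hN, χ₀, -, hv⟩ :=
    h (fun ℓ _ v hv =>
        @unramifiedPstWeilDeligneData (v.adicCompletion ℚ) _ _ _ _ ℓ _
          (fontainePstAdicCompletion v ℓ hv).algebra)
      1951 prime_1951_and_le.2
  have hloc : (ρ.toLocal v1951).IsLocallyUnramified :=
    (@unramifiedPstWeilDeligneData_isDeRhamFramed_iff (v1951.adicCompletion ℚ) _ _ _ _ 1951 _
      (fontainePstAdicCompletion v1951 1951 natCast_mem_v1951).algebra 2 (ρ.toLocal v1951)).1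
      (hdR v1951 natCast_mem_v1951)
  exact not_isUnramifiedAt_of_artinConductorNat ρ hN (fun v hv' => (hv v hv').1)
    (isUnramifiedAt_of_isLocallyUnramified_toLocal ρ v1951 hloc)


/-! ### §A′ Which clauses of `IsFontaineDatum` are live: (F2), (F4), (F7) -/

/-- **(F8) for the truncated datum.** For `F̂_nr` the relation `IsWeilDeligneOf ρ r` is
`r.N = 0 ∧ r.ρ ≅ ρ|_{W_F}`, so clause (F8) of `IsFontaineDatum` holds for it. [folklore] -/
theorem unramifiedPstWeilDeligneData_clauseF8 {F : Type} [Field F] [ValuativeRel F]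
    [TopologicalSpace F] [IsNonarchimedeanLocalField F] {ℓ : ℕ} [Fact ℓ.Prime] [Algebra ℚ_[ℓ] F]
    {n : ℕ} (ρ : FramedRep (absoluteGaloisGroup F) (PadicAlgCl ℓ) n)
    (r : WeilDeligneRep F (PadicAlgCl ℓ) (Fin n → PadicAlgCl ℓ)) (hρ : ρ.IsLocallyUnramified)
    (hr : (unramifiedPstWeilDeligneData F ℓ).IsWeilDeligneOf ρ r) :
    r.IsEquivalent
      (WeilDeligneRep.ofRep (ρ.weilRestrict F) hρ.isUnramifiedRep_weilRestrict.isContinuousRep) := by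
  obtain ⟨hN, ⟨e⟩⟩ := (unramifiedPstWeilDeligneData_isWeilDeligneOf_iff ρ r).1 hr
  exact ⟨{ toRepEquiv := e
           comm_N := by rw [hN, WeilDeligneRep.ofRep_N, LinearMap.comp_zero, LinearMap.zero_comp] }⟩

/-- `IcosahedralSupplyWithoutPin` restricted to datum families satisfying clauses (F1), (F3), (F5),
(F6), (F8) of `IsFontaineDatum` at every `v ∣ ℓ` (the clauses the truncated datum provably meets).
[folklore] -/
def IcosahedralSupplyWithoutCyclotomicClauses : Prop :=
  ∀ (pst : ∀ (ℓ : ℕ) [Fact ℓ.Prime] (v : HeightOneSpectrum (𝓞 ℚ)),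
      ((ℓ : ℕ) : 𝓞 ℚ) ∈ v.asIdeal → PstWeilDeligneData (v.adicCompletion ℚ) ℓ),
    (∀ (ℓ : ℕ) [Fact ℓ.Prime] (v : HeightOneSpectrum (𝓞 ℚ)) (hv : ((ℓ : ℕ) : 𝓞 ℚ) ∈ v.asIdeal),
      (pst ℓ v hv).algebra = LocalField.adicCompletionPadicAlgebra v ℓ hv ∧
      (pst ℓ v hv).UnramifiedWeightsZero ∧
      (pst ℓ v hv).HasCrystallineDeformationRings ∧
      (pst ℓ v hv).HasHodgeTypeCrystallineDeformationRings ∧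
      ∀ {n : ℕ} (ρ : FramedRep (absoluteGaloisGroup (v.adicCompletion ℚ)) (PadicAlgCl ℓ) n)
        (r : WeilDeligneRep (v.adicCompletion ℚ) (PadicAlgCl ℓ) (Fin n → PadicAlgCl ℓ))
        (hρ : ρ.IsLocallyUnramified), (pst ℓ v hv).IsWeilDeligneOf ρ r →
          r.IsEquivalent (WeilDeligneRep.ofRep (ρ.weilRestrict (v.adicCompletion ℚ))
            hρ.isUnramifiedRep_weilRestrict.isContinuousRep)) →
    ∀ (ℓ : ℕ) [Fact ℓ.Prime], 17 ≤ ℓ →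
      ∃ (ι : PadicAlgCl ℓ ≃+* ℂ) (ρ : FramedGaloisRep ℚ (PadicAlgCl ℓ) 2),
        ((∀ᶠ v : HeightOneSpectrum (𝓞 ℚ) in Filter.cofinite, ρ.IsUnramifiedAt v) ∧
          ∀ (v : HeightOneSpectrum (𝓞 ℚ)) (hv : ((ℓ : ℕ) : 𝓞 ℚ) ∈ v.asIdeal),
            (pst ℓ v hv).IsDeRhamFramed (ρ.toLocal v)) ∧
        (ρ.toGaloisRep.IsIrreducible ∧ (Set.range ρ).Finite ∧ ρ.IsEven ∧
          ρ.toGaloisRep.artinConductorNat = 1951 ∧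
          ∃ χ₀ : DirichletCharacter ℂ 1951, orderOf χ₀ = 5 ∧
            ∀ v : HeightOneSpectrum (𝓞 ℚ), v.residueCard ≠ 1951 →
              ρ.IsUnramifiedAt v ∧ ∃ t d : PadicAlgCl ℓ,
                ρ.HasFrobCharpolyAt v
                  (Polynomial.X ^ 2 - Polynomial.C t * Polynomial.X + Polynomial.C d) ∧
                ι d = (χ₀ (v.residueCard : ZMod 1951))⁻¹ ∧
                (t ^ 2 = 0 ∨ t ^ 2 = d ∨ t ^ 2 = 4 * d ∨ t ^ 4 - 3 * d * t ^ 2 + d ^ 2 = 0))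

/-- **The live clauses are (F2), (F4), (F7)** (landed as
`Theorems/IcosahedralSupply/Negative/FalseWithoutCyclotomicClauses.lean`, p128424): even for datum families
meeting (F1), (F3), (F5), (F6), (F8), the uniform crux fails — same witness (truncated family on
the canonical `ℚ_ℓ`-structure, `ℓ = 1951`). Under `FontaineDatumExists` a proof of the crux as
typed must therefore use (F2) `CyclotomicWeightNegOne`, (F4) `χ_cyc` crystalline or (F7)
`CrystallineGenericFibreRegular` to make a RAMIFIED finite-image `ρ|_{Γ_{ℚ_{1951}}}` de Rham.
[folklore] -/
theorem icosahedralSupply_false_without_cyclotomic_clauses :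
    ¬ IcosahedralSupplyWithoutCyclotomicClauses := by
  intro h
  haveI : Fact (Nat.Prime 1951) := ⟨prime_1951_and_le.1⟩
  have hcl := h (fun ℓ _ v hv =>
      @unramifiedPstWeilDeligneData (v.adicCompletion ℚ) _ _ _ _ ℓ _
        (LocalField.adicCompletionPadicAlgebra v ℓ hv))
    (fun ℓ _ v hv => by
      letI := LocalField.adicCompletionPadicAlgebra v ℓ hv
      exact ⟨rfl, unramifiedPstWeilDeligneData_unramifiedWeightsZero,
        unramifiedPstWeilDeligneData_hasCrystallineDeformationRings _ _,
        unramifiedPstWeilDeligneData_hasHodgeTypeCrystallineDeformationRings _ _,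
        fun ρ r hρ hr => unramifiedPstWeilDeligneData_clauseF8 ρ r hρ hr⟩)
    1951 prime_1951_and_le.2
  obtain ⟨ι, ρ, ⟨-, hdR⟩, -, -, -, hN, χ₀, -, hv⟩ := hcl
  have hloc : (ρ.toLocal v1951).IsLocallyUnramified :=
    (@unramifiedPstWeilDeligneData_isDeRhamFramed_iff (v1951.adicCompletion ℚ) _ _ _ _ 1951 _
      (LocalField.adicCompletionPadicAlgebra v1951 1951 natCast_mem_v1951) 2 (ρ.toLocal v1951)).1
      (hdR v1951 natCast_mem_v1951)
  exact not_isUnramifiedAt_of_artinConductorNat ρ hN (fun v hv' => (hv v hv').1)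
    (isUnramifiedAt_of_isLocallyUnramified_toLocal ρ v1951 hloc)

/-! ### §D What the crux entails at `ℓ = 1951` (the stub nobody can fill today) -/

/-- The crux implies that the PINNED datum at `(ℚ_{1951}, 1951)` admits a de Rham representation
that is RAMIFIED (finite image, conductor `1951`): a statement about `Classical.epsilon
(IsFontaineDatum _)` that no structure axiom and no clause (F1)–(F8) delivers. [folklore] -/
theorem ramified_deRham_of_icosahedralSupply
    (h : Summit.Langlands.Langlands.Theses.QuarterDeficit1951.IcosahedralSupply)
    (RD : Summit.Langlands.ReciprocityData ℚ) :
    haveI : Fact (Nat.Prime 1951) := ⟨prime_1951_and_le.1⟩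
    ∃ ρ : FramedGaloisRep ℚ (PadicAlgCl 1951) 2,
      (Set.range ρ).Finite ∧ ¬ ρ.IsUnramifiedAt v1951 ∧
        ¬ (ρ.toLocal v1951).IsLocallyUnramified ∧
        (fontainePstAdicCompletion v1951 1951 natCast_mem_v1951).IsDeRhamFramed
          (ρ.toLocal v1951) := by
  haveI : Fact (Nat.Prime 1951) := ⟨prime_1951_and_le.1⟩
  obtain ⟨ι, ρ, ⟨-, hdR⟩, -, hfin, -, hN, χ₀, -, hv⟩ := h RD 1951 prime_1951_and_le.2
  have hram := not_isUnramifiedAt_of_artinConductorNat ρ hN (fun v hv' => (hv v hv').1)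
  exact ⟨ρ, hfin, hram,
    fun hloc => hram (isUnramifiedAt_of_isLocallyUnramified_toLocal ρ v1951 hloc),
    hdR v1951 natCast_mem_v1951⟩

end Summit.Langlands.Langlands.Cruxes.IcosahedralSupply.Disproof

end
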